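import Summits.AtomisticToContinuum.Crystallization.Theorems.FrustratedLawDichotomyStrainedPatchHomExemptMoveBox
import Summits.AtomisticToContinuum.Crystallization.Theorems.FrustratedLawDichotomyStrainedPatchHomForceRing

/-!
# ZERO-STEP EXEMPT PRUNE: a radial force component `> S₇♯(7)` at the centre ALONE gives `ExemptNear` (no `τ`-enclosure), the oddness of the
# unshifted family, and the SLAB / EXEMPT DICHOTOMY of the analytic slab `T″` (27623 `(H) HomFloor (1/625)`, hcp half; critic rows 1108 / 1110)

decomp-a2c hand-1 g29 (crux `AperiodicFrustratedLawGap`, stmt-AtomisticToContinuum-27623).  Hand-1 g26's `…HomExemptMoveBox.exemptNear_of_boxSlope`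
realises the exempt prune from a slope bound `≤ −b` of the one-atom move on a whole step interval `τ ∈ [0, s]` plus the slack inequality
`s·(7/(7−s))⁷·S₇♯(7) < b·s`; every Boolean force leaf so far (`forceOutDir`, `forceOutC`) therefore encloses the slope over a `τ`-interval.  For the
ANALYTIC SLAB of BUDGET-F (critic rows 1085 / 1089 / 1108 / 1110: ring lemma `…HomForceRing.hcpForceLJ_exterior` ⟹ every shuffle of the λ-ball outside
the slab is exempt) the step is a nuisance parameter, and this file removes it:

* §1 `moveKernel_zero`, `continuousAt_moveKernel` — the slope kernel at `τ = 0` is MINUS the force kernel `(‖v‖⁻⁸ − ‖v‖⁻¹⁴)⟪v, e⟫`, and is continuous in `τ` at `0`;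
  ★ `forceBoxSumA_eq_zero` — the UNSHIFTED family's force component along any `e` vanishes identically (the kernel is odd, the box `[−11,11]³` and
  the lattice are centrosymmetric): at `τ = 0` only the shifted family acts on the centre;
* §2 ★★★ `exemptNear_of_force_gt` — ZERO-STEP EXEMPT PRUNE: if the box-sum force component along a direction `e` (`‖e‖ ≤ 1`) exceeds the move slack,
  `S₇♯(7) < Σ_A 𝟙·(‖v‖⁻⁸ − ‖v‖⁻¹⁴)⟪v, e⟫ + Σ_B 𝟙·(‖X‖⁻⁸ − ‖X‖⁻¹⁴)⟪X, e⟫`, then `ExemptNear (9/5) ExRec z c` — by CONTINUITY of the slope in `τ` at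
  `0` and of `s ↦ (7/(7−s))⁷` a small enough step exists; ★★★ `exemptNear_of_forceB_gt` — the same with the `A`-sum dropped (§1);
* §3 ★★★ `slab_or_exempt_of_ring` — THE ANALYTIC SLAB DICHOTOMY: for a label finset `B` certainly inside the `7`-ball, the other in-ball labels of the
  box priced by `|R|·6⁻⁷` (each in-ball label `≥ 6` from the centre contributes `≤ 6⁻⁷` along a unit direction), a curvature floor `q ≤ Σ_B segGd` along the segment from the
  reference shuffle `ξ₀` (any real `q`: the kernel's `(lamS/SC)‖Δ‖² + ⟨Δ, (D/SC)Δ⟩` of `…HomCurvLJAnisoM.curvLJ_floorM_of_check`) and a reference force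
  bound `f₀` (`…HomSlopeLJ.forceLJ_ref_bound_of_check`): EITHER `q ≤ (S₇♯(7) + f₀ + |R|·6⁻⁷)·‖U(ξ − ξ₀)‖` (the shuffle lies in the slab — the fit leaf's
  territory) OR `ExemptNear (9/5) ExRec z c`.  This is the real-side statement the ring leaf `entryLeafOKHT`'s `[F]`-part realises, with NO step `s`.

NO definitions; 0 sorry; standard axioms; no instances / notation / `#eval`.  `--supports stmt-AtomisticToContinuum-27623`.
-/

noncomputable section

namespace Summit.AtomisticToContinuum.Crystallization.Theorems.FrustratedLawDichotomyStrainedPatchHomExemptZeroStep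

open scoped BigOperators RealInnerProductSpace
open Summit.AtomisticToContinuum.Crystallization.Theorems.ChargedEnergyGapNegative (E3)
open Summit.AtomisticToContinuum.Crystallization.Theorems.FrustratedLawDichotomyExemptAbsorption (ExemptNear)
open Summit.AtomisticToContinuum.Crystallization.Theorems.FrustratedLawDichotomyStrainedPatchHomSplit (ExRec latPt hexFrame hcpShift)
open Summit.AtomisticToContinuum.Crystallization.Theorems.FrustratedLawDichotomyStrainedPatchHomLattice (latPt_neg)
open Summit.AtomisticToContinuum.Crystallization.Theorems.FrustratedLawDichotomyStrainedPatchHomLatticeBoxHcp (norm_shifted_gt)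
open Summit.AtomisticToContinuum.Crystallization.Theorems.FrustratedLawDichotomyStrainedPatchHomExemptMove (exemptNear_of_boxSlope)
open Summit.AtomisticToContinuum.Crystallization.Theorems.FrustratedLawDichotomyStrainedPatchHomForceRing (hcpForceLJ_exterior)
open Summit.AtomisticToContinuum.Crystallization.Theorems.FrustratedLawDichotomyStrainedPatchTaylorChord (segN segS segGd)

/-! ## §1. The slope kernel at `τ = 0`, its continuity in `τ`, and the oddness of the unshifted family -/

/-- At `τ = 0` the slope kernel of the one-atom move is minus the force kernel `(‖v‖⁻⁸ − ‖v‖⁻¹⁴)⟪v, e⟫`. [arithmetic] -/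
theorem moveKernel_zero (v e : E3) :
    (if v ≠ 0 ∧ ‖v‖ ≤ 7 then ((‖(0 : ℝ) • e - v‖⁻¹) ^ 8 - (‖(0 : ℝ) • e - v‖⁻¹) ^ 14) * ⟪(0 : ℝ) • e - v, e⟫ else 0) =
      -(if v ≠ 0 ∧ ‖v‖ ≤ 7 then (‖v‖⁻¹ ^ 8 - ‖v‖⁻¹ ^ 14) * ⟪v, e⟫ else 0) := by
  split_ifs
  · simp only [zero_smul, zero_sub, norm_neg, inner_neg_left, mul_neg]
  · simp

/-- The slope kernel of one displacement is continuous in the step `τ` at `τ = 0` (the displacement is nonzero whenever the kernel is live). [folklore] -/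
theorem continuousAt_moveKernel (v e : E3) :
    ContinuousAt (fun τ : ℝ => if v ≠ 0 ∧ ‖v‖ ≤ 7 then ((‖τ • e - v‖⁻¹) ^ 8 - (‖τ • e - v‖⁻¹) ^ 14) * ⟪τ • e - v, e⟫ else 0) 0 := by
  by_cases h : v ≠ 0 ∧ ‖v‖ ≤ 7
  · simp only [if_pos h]
    have hc : Continuous fun τ : ℝ => τ • e - v := (continuous_id.smul continuous_const).sub continuous_const
    have h0 : ‖(0 : ℝ) • e - v‖ ≠ 0 := by
      rw [zero_smul, zero_sub, norm_neg]
      exact norm_ne_zero_iff.2 h.1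
    have hn : ContinuousAt (fun τ : ℝ => ‖τ • e - v‖⁻¹) 0 := hc.norm.continuousAt.inv₀ h0
    exact ((hn.pow 8).sub (hn.pow 14)).mul (hc.inner continuous_const).continuousAt
  · simp only [if_neg h]
    exact continuousAt_const

/-- ★ **ODDNESS OF THE UNSHIFTED FAMILY**: the box-sum force component of the unshifted (`A`) family along any `e` vanishes — `bb ↦ −bb` preserves the
box `[−11,11]³`, negates `latPt U hexFrame bb`, preserves the indicator and negates the kernel. [folklore: odd kernel on a centrosymmetric set] -/
theorem forceBoxSumA_eq_zero (U : E3 →L[ℝ] E3) (e : E3) :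
    ∑ bb ∈ (Fintype.piFinset fun _ : Fin 3 => Finset.Icc (-11 : ℤ) 11),
      (if latPt U hexFrame bb ≠ 0 ∧ ‖latPt U hexFrame bb‖ ≤ 7 then
        (‖latPt U hexFrame bb‖⁻¹ ^ 8 - ‖latPt U hexFrame bb‖⁻¹ ^ 14) * ⟪latPt U hexFrame bb, e⟫ else 0) = 0 := by
  set box := (Fintype.piFinset fun _ : Fin 3 => Finset.Icc (-11 : ℤ) 11) with hbox
  set g : E3 → ℝ := fun v => if v ≠ 0 ∧ ‖v‖ ≤ 7 then (‖v‖⁻¹ ^ 8 - ‖v‖⁻¹ ^ 14) * ⟪v, e⟫ else 0 with hg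
  have hodd : ∀ v : E3, g (-v) = -g v := by
    intro v
    simp only [hg, norm_neg, inner_neg_left, neg_ne_zero, mul_neg]
    split_ifs <;> simp
  have hmem : ∀ bb : Fin 3 → ℤ, bb ∈ box ↔ -bb ∈ box := by
    intro bb
    simp only [hbox, Fintype.mem_piFinset, Finset.mem_Icc, Pi.neg_apply]
    constructor
    · intro h i; have := h i; omega
    · intro h i; have := h i; omega
  have hre : ∑ bb ∈ box, g (latPt U hexFrame bb) = ∑ bb ∈ box, g (latPt U hexFrame (-bb)) :=
    Finset.sum_equiv (Equiv.neg (Fin 3 → ℤ)) (fun bb => hmem bb) (fun bb _ => by simp only [Equiv.neg_apply, neg_neg])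
  have hneg : ∑ bb ∈ box, g (latPt U hexFrame (-bb)) = -∑ bb ∈ box, g (latPt U hexFrame bb) := by
    rw [← Finset.sum_neg_distrib]
    exact Finset.sum_congr rfl fun bb _ => by rw [latPt_neg, hodd]
  show ∑ bb ∈ box, g (latPt U hexFrame bb) = 0
  linarith [hre.trans hneg]

/-! ## §2. ★★★ The zero-step exempt prune -/

/-- ★★★ **ZERO-STEP EXEMPT PRUNE.**  Homogeneous hcp `133/10`-ball with data `(U, ξ)` (`‖U − 1‖ ≤ 1/4`, `‖ξ‖ ≤ 1/4`, the `hver` range hypothesis), a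
direction `e` with `‖e‖ ≤ 1`.  If the box-sum FORCE COMPONENT along `e` at the centre — both families over `[−11,11]³`, kernel
`v ↦ 𝟙[v ≠ 0 ∧ ‖v‖ ≤ 7]·(‖v‖⁻⁸ − ‖v‖⁻¹⁴)⟪v, e⟫` — strictly exceeds the move slack `S₇♯(7) = 6000/343·7⁻⁴ + 2880/49·7⁻⁵ + 10/7·7⁻⁶ + 2·7⁻⁷`, then
`ExemptNear (9/5) ExRec z c`.  (The slope of the move `τ ↦ z c + τe` at `τ = 0` is minus this component; by continuity it stays `≤ −b` for some
`b > (7/(7−s))⁷ S₇♯(7)` on a short enough step `[0, s]`, and `…HomExemptMoveBox.exemptNear_of_boxSlope` applies.) [folklore: continuity + hand-1 g26's prune] -/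
theorem exemptNear_of_force_gt {M : ℕ} {z : Fin M → E3} {c : Fin M} (hz : Function.Injective z) {U : E3 →L[ℝ] E3} {ξ : E3}
    (hU : ‖U - 1‖ ≤ 1 / 4) (hξ : ‖ξ‖ ≤ 1 / 4)
    (hrange : Set.range z = {x : E3 | dist x (z c) ≤ 133 / 10 ∧ ∃ a : Fin 3 → ℤ,
      x = z c + latPt U hexFrame a ∨ x = z c + latPt U hexFrame a + U (hcpShift + ξ)})
    (e : E3) (he : ‖e‖ ≤ 1)
    (hforce : (6000 / 343 * (7 : ℝ)⁻¹ ^ 4 + 2880 / 49 * (7 : ℝ)⁻¹ ^ 5 + 10 / 7 * (7 : ℝ)⁻¹ ^ 6 + 2 * (7 : ℝ)⁻¹ ^ 7) <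
      ∑ bb ∈ (Fintype.piFinset fun _ : Fin 3 => Finset.Icc (-11 : ℤ) 11),
          (if latPt U hexFrame bb ≠ 0 ∧ ‖latPt U hexFrame bb‖ ≤ 7 then
            (‖latPt U hexFrame bb‖⁻¹ ^ 8 - ‖latPt U hexFrame bb‖⁻¹ ^ 14) * ⟪latPt U hexFrame bb, e⟫ else 0) +
        ∑ bb ∈ (Fintype.piFinset fun _ : Fin 3 => Finset.Icc (-11 : ℤ) 11),
          (if latPt U hexFrame bb + U (hcpShift + ξ) ≠ 0 ∧ ‖latPt U hexFrame bb + U (hcpShift + ξ)‖ ≤ 7 then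
            (‖latPt U hexFrame bb + U (hcpShift + ξ)‖⁻¹ ^ 8 - ‖latPt U hexFrame bb + U (hcpShift + ξ)‖⁻¹ ^ 14) *
              ⟪latPt U hexFrame bb + U (hcpShift + ξ), e⟫ else 0)) :
    ExemptNear (9 / 5) ExRec z c := by
  set box := (Fintype.piFinset fun _ : Fin 3 => Finset.Icc (-11 : ℤ) 11) with hbox
  set S7 : ℝ := 6000 / 343 * (7 : ℝ)⁻¹ ^ 4 + 2880 / 49 * (7 : ℝ)⁻¹ ^ 5 + 10 / 7 * (7 : ℝ)⁻¹ ^ 6 + 2 * (7 : ℝ)⁻¹ ^ 7 with hS7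
  -- the slope kernel as a function of the step and the displacement
  set k : ℝ → E3 → ℝ := fun τ v =>
    if v ≠ 0 ∧ ‖v‖ ≤ 7 then ((‖τ • e - v‖⁻¹) ^ 8 - (‖τ • e - v‖⁻¹) ^ 14) * ⟪τ • e - v, e⟫ else 0 with hk
  set g : E3 → ℝ := fun v => if v ≠ 0 ∧ ‖v‖ ≤ 7 then (‖v‖⁻¹ ^ 8 - ‖v‖⁻¹ ^ 14) * ⟪v, e⟫ else 0 with hg
  set F : ℝ → ℝ := fun τ => ∑ bb ∈ box, k τ (latPt U hexFrame bb) + ∑ bb ∈ box, k τ (latPt U hexFrame bb + U (hcpShift + ξ)) with hF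
  set P : ℝ := ∑ bb ∈ box, g (latPt U hexFrame bb) + ∑ bb ∈ box, g (latPt U hexFrame bb + U (hcpShift + ξ)) with hP
  have hP' : S7 < P := hforce
  have hk0 : ∀ v : E3, k 0 v = -g v := fun v => moveKernel_zero v e
  have hF0 : F 0 = -P := by
    simp only [hF, hP, hk0, Finset.sum_neg_distrib]
    ring
  -- continuity of the slope at `τ = 0`
  have hFc : ContinuousAt F 0 := by
    have h1 : ContinuousAt (fun τ => ∑ bb ∈ box, k τ (latPt U hexFrame bb)) 0 :=
      tendsto_finsetSum box fun bb _ => continuousAt_moveKernel (latPt U hexFrame bb) e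
    have h2 : ContinuousAt (fun τ => ∑ bb ∈ box, k τ (latPt U hexFrame bb + U (hcpShift + ξ))) 0 :=
      tendsto_finsetSum box fun bb _ => continuousAt_moveKernel (latPt U hexFrame bb + U (hcpShift + ξ)) e
    exact h1.add h2
  -- the margin and the slope threshold
  set m : ℝ := (P - S7) / 2 with hm
  have hm0 : 0 < m := by rw [hm]; exact half_pos (sub_pos.2 hP')
  set b : ℝ := S7 + m with hb
  obtain ⟨δ, hδ0, hδ⟩ := Metric.continuousAt_iff.1 hFc m hm0
  -- continuity of the slack factor `s ↦ (7/(7−s))⁷·S₇♯(7)` at `s = 0`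
  have hGc : ContinuousAt (fun s : ℝ => (7 / (7 - s)) ^ 7 * S7) 0 :=
    ((continuousAt_const.div (continuousAt_const.sub continuousAt_id) (by norm_num)).pow 7).mul continuousAt_const
  obtain ⟨δ₁, hδ₁0, hδ₁⟩ := Metric.continuousAt_iff.1 hGc m hm0
  -- the step
  set s : ℝ := min (min (δ / 2) (δ₁ / 2)) (3 / 8) with hs
  have hs0 : 0 < s := by
    rw [hs]
    exact lt_min (lt_min (by linarith) (by linarith)) (by norm_num)
  have hs38 : s ≤ 3 / 8 := min_le_right _ _
  have hsδ : s < δ := lt_of_le_of_lt ((min_le_left _ _).trans (min_le_left _ _)) (by linarith)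
  have hsδ₁ : s < δ₁ := lt_of_le_of_lt ((min_le_left _ _).trans (min_le_right _ _)) (by linarith)
  -- slope bound on `[0, s]`
  have hslope : ∀ τ ∈ Set.Icc (0 : ℝ) s, F τ ≤ -b := by
    intro τ hτ
    have hd : dist τ 0 < δ := by
      rw [Real.dist_eq, sub_zero, abs_of_nonneg hτ.1]
      exact lt_of_le_of_lt hτ.2 hsδ
    have h := hδ hd
    rw [Real.dist_eq] at h
    have h' := (abs_lt.1 h).2
    rw [hF0] at h'
    rw [hb, hm] at *
    linarith
  -- the slack inequality
  have hslack : s * (7 / (7 - s)) ^ 7 * S7 < b * s := by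
    have hd : dist s 0 < δ₁ := by rw [Real.dist_eq, sub_zero, abs_of_pos hs0]; exact hsδ₁
    have h := hδ₁ hd
    rw [Real.dist_eq] at h
    have h' := (abs_lt.1 h).2
    have h0 : ((7 : ℝ) / (7 - 0)) ^ 7 * S7 = S7 := by norm_num
    rw [h0] at h'
    have hlt : (7 / (7 - s)) ^ 7 * S7 < b := by rw [hb]; linarith
    have := mul_lt_mul_of_pos_left hlt hs0
    calc s * (7 / (7 - s)) ^ 7 * S7 = s * ((7 / (7 - s)) ^ 7 * S7) := by ring
      _ < s * b := this
      _ = b * s := by ring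
  exact exemptNear_of_boxSlope hz hU hξ hrange e he hs0 hs38 (fun τ hτ => hslope τ hτ) hslack

/-- ★★★ **ZERO-STEP EXEMPT PRUNE, SHIFTED FAMILY ONLY** (the unshifted family's component vanishes, §1): if
`S₇♯(7) < Σ_{bb ∈ [−11,11]³} 𝟙[‖X_bb‖ ≤ 7]·(‖X_bb‖⁻⁸ − ‖X_bb‖⁻¹⁴)⟪X_bb, e⟫`, `X_bb = latPt U hexFrame bb + U(hcpShift + ξ)`, for some `‖e‖ ≤ 1`, then
`ExemptNear (9/5) ExRec z c`. [folklore chaining] -/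
theorem exemptNear_of_forceB_gt {M : ℕ} {z : Fin M → E3} {c : Fin M} (hz : Function.Injective z) {U : E3 →L[ℝ] E3} {ξ : E3}
    (hU : ‖U - 1‖ ≤ 1 / 4) (hξ : ‖ξ‖ ≤ 1 / 4)
    (hrange : Set.range z = {x : E3 | dist x (z c) ≤ 133 / 10 ∧ ∃ a : Fin 3 → ℤ,
      x = z c + latPt U hexFrame a ∨ x = z c + latPt U hexFrame a + U (hcpShift + ξ)})
    (e : E3) (he : ‖e‖ ≤ 1)
    (hforce : (6000 / 343 * (7 : ℝ)⁻¹ ^ 4 + 2880 / 49 * (7 : ℝ)⁻¹ ^ 5 + 10 / 7 * (7 : ℝ)⁻¹ ^ 6 + 2 * (7 : ℝ)⁻¹ ^ 7) <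
      ∑ bb ∈ (Fintype.piFinset fun _ : Fin 3 => Finset.Icc (-11 : ℤ) 11),
        (if latPt U hexFrame bb + U (hcpShift + ξ) ≠ 0 ∧ ‖latPt U hexFrame bb + U (hcpShift + ξ)‖ ≤ 7 then
          (‖latPt U hexFrame bb + U (hcpShift + ξ)‖⁻¹ ^ 8 - ‖latPt U hexFrame bb + U (hcpShift + ξ)‖⁻¹ ^ 14) *
            ⟪latPt U hexFrame bb + U (hcpShift + ξ), e⟫ else 0)) :
    ExemptNear (9 / 5) ExRec z c := by
  refine exemptNear_of_force_gt hz hU hξ hrange e he ?_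
  rw [forceBoxSumA_eq_zero U e, zero_add]
  exact hforce

/-! ## §3. ★★★ The analytic slab: SLAB / EXEMPT dichotomy from the ring lemma -/

/-- In the degenerate direction every `segGd` vanishes. [formal bookkeeping] -/
theorem segGd_of_zero (W₁ : ℝ → ℝ) (p : E3) (s : ℝ) : segGd W₁ p 0 s = 0 := by
  simp [segGd, segS, segN]

/-- A far in-ball displacement contributes little force along a unit direction: for `6 ≤ ‖X‖` and `‖e‖ ≤ 1`,
`|𝟙[X ≠ 0 ∧ ‖X‖ ≤ 7]·(‖X‖⁻⁸ − ‖X‖⁻¹⁴)⟪X, e⟫| ≤ 6⁻⁷`. [arithmetic] -/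
theorem abs_forceKernel_le_of_six_le {X e : E3} (hX : 6 ≤ ‖X‖) (he : ‖e‖ ≤ 1) :
    |(if X ≠ 0 ∧ ‖X‖ ≤ 7 then (‖X‖⁻¹ ^ 8 - ‖X‖⁻¹ ^ 14) * ⟪X, e⟫ else 0)| ≤ (6 : ℝ)⁻¹ ^ 7 := by
  split_ifs with h
  · have hr : 0 < ‖X‖ := by linarith
    have hinner : |⟪X, e⟫| ≤ ‖X‖ := by
      calc |⟪X, e⟫| ≤ ‖X‖ * ‖e‖ := abs_real_inner_le_norm _ _
        _ ≤ ‖X‖ * 1 := by gcongr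
        _ = ‖X‖ := mul_one _
    have hu : ‖X‖⁻¹ ≤ 6⁻¹ := inv_anti₀ (by norm_num) hX
    have hu0 : 0 ≤ ‖X‖⁻¹ := inv_nonneg.2 hr.le
    have hu1 : ‖X‖⁻¹ ≤ 1 := hu.trans (by norm_num)
    have hcoef : 0 ≤ ‖X‖⁻¹ ^ 8 - ‖X‖⁻¹ ^ 14 := by
      have : ‖X‖⁻¹ ^ 14 ≤ ‖X‖⁻¹ ^ 8 := pow_le_pow_of_le_one hu0 hu1 (by norm_num)
      linarith
    have h14 : 0 ≤ ‖X‖⁻¹ ^ 14 := pow_nonneg hu0 14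
    rw [abs_mul, abs_of_nonneg hcoef]
    calc (‖X‖⁻¹ ^ 8 - ‖X‖⁻¹ ^ 14) * |⟪X, e⟫| ≤ ‖X‖⁻¹ ^ 8 * ‖X‖ :=
          mul_le_mul (by linarith) hinner (abs_nonneg _) (pow_nonneg hu0 _)
      _ = ‖X‖⁻¹ ^ 7 := by
          rw [show (8 : ℕ) = 7 + 1 from rfl, pow_succ, mul_assoc, inv_mul_cancel₀ hr.ne', mul_one]
      _ ≤ 6⁻¹ ^ 7 := pow_le_pow_left₀ hu0 hu 7
  · rw [abs_zero]; positivity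

/-- ★ **PRICING THE LABELS OUTSIDE `B`**: if every in-ball displacement of the box outside `B` belongs to `R` and is `≥ 6` from the centre, the rest of
the box-sum force component along any `‖e‖ ≤ 1` is `≥ −|R|·6⁻⁷`. [folklore] -/
theorem forceRest_ge (box B R : Finset (Fin 3 → ℤ)) (X : (Fin 3 → ℤ) → E3)
    (hR : ∀ bb ∈ box \ B, ‖X bb‖ ≤ 7 → bb ∈ R ∧ 6 ≤ ‖X bb‖) {e : E3} (he : ‖e‖ ≤ 1) :
    -((R.card : ℝ) * (6 : ℝ)⁻¹ ^ 7) ≤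
      ∑ bb ∈ box \ B, (if X bb ≠ 0 ∧ ‖X bb‖ ≤ 7 then (‖X bb‖⁻¹ ^ 8 - ‖X bb‖⁻¹ ^ 14) * ⟪X bb, e⟫ else 0) := by
  classical
  set f : (Fin 3 → ℤ) → ℝ := fun bb => if X bb ≠ 0 ∧ ‖X bb‖ ≤ 7 then (‖X bb‖⁻¹ ^ 8 - ‖X bb‖⁻¹ ^ 14) * ⟪X bb, e⟫ else 0 with hf
  have hfilter : ∑ bb ∈ (box \ B).filter (fun bb => ‖X bb‖ ≤ 7), f bb = ∑ bb ∈ box \ B, f bb := by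
    refine Finset.sum_filter_of_ne fun bb _ hne => ?_
    by_contra hgt
    exact hne (by simp only [hf]; rw [if_neg (fun h => hgt h.2)])
  have hsub : (box \ B).filter (fun bb => ‖X bb‖ ≤ 7) ⊆ R := by
    intro bb hbb
    rw [Finset.mem_filter] at hbb
    exact (hR bb hbb.1 hbb.2).1
  have habs : ∀ bb ∈ (box \ B).filter (fun bb => ‖X bb‖ ≤ 7), |f bb| ≤ (6 : ℝ)⁻¹ ^ 7 := by
    intro bb hbb
    rw [Finset.mem_filter] at hbb
    exact abs_forceKernel_le_of_six_le (hR bb hbb.1 hbb.2).2 he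
  have hsum : |∑ bb ∈ (box \ B).filter (fun bb => ‖X bb‖ ≤ 7), f bb| ≤ ((box \ B).filter (fun bb => ‖X bb‖ ≤ 7)).card * (6 : ℝ)⁻¹ ^ 7 := by
    calc |∑ bb ∈ (box \ B).filter (fun bb => ‖X bb‖ ≤ 7), f bb| ≤ ∑ bb ∈ (box \ B).filter (fun bb => ‖X bb‖ ≤ 7), |f bb| :=
          Finset.abs_sum_le_sum_abs _ _
      _ ≤ ∑ bb ∈ (box \ B).filter (fun bb => ‖X bb‖ ≤ 7), (6 : ℝ)⁻¹ ^ 7 := Finset.sum_le_sum habs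
      _ = _ := by rw [Finset.sum_const, nsmul_eq_mul]
  have hcard : (((box \ B).filter (fun bb => ‖X bb‖ ≤ 7)).card : ℝ) ≤ R.card := by exact_mod_cast Finset.card_le_card hsub
  have h67 : (0 : ℝ) ≤ 6⁻¹ ^ 7 := by positivity
  rw [← hfilter]
  have h1 := (abs_le.1 hsum).1
  nlinarith

/-- ★★★ **THE ANALYTIC SLAB DICHOTOMY** (`T″` of BUDGET-F; critic rows 1085 / 1089 / 1108 / 1110).  Homogeneous hcp `133/10`-ball with data `(U, ξ)`,
a reference shuffle `ξ₀` (`‖U − 1‖ ≤ 1/4`, `‖ξ₀‖, ‖ξ‖ ≤ 1/4`), a label finset `B ⊆ [−11,11]³` certainly inside the `7`-ball at `ξ`, the other in-ball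
labels of the box contained in `R` and `≥ 6` from the centre, a curvature floor `q ≤ Σ_B segGd` of the LJ profile along the segment from `ξ₀` to `ξ` (ANY real
`q` — the kernel supplies `(lamS/SC)‖Δ‖² + ⟨Δ, (D/SC)Δ⟩` from `…HomCurvLJAnisoM.curvLJ_floorM_of_check`, `Δ = U(ξ − ξ₀)`), and a reference force bound
`f₀` (`…HomSlopeLJ.forceLJ_ref_bound_of_check`).  THEN: either `q ≤ (S₇♯(7) + f₀ + |R|·6⁻⁷)·‖U(ξ − ξ₀)‖` — the shuffle lies in the SLAB, to be
covered by the fit leaf — or `ExemptNear (9/5) ExRec z c` (the one-atom move of the centre along `Δ/‖Δ‖` lowers its energy).  No step parameter.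
[folklore chaining: `…HomForceRing.hcpForceLJ_exterior` with `λ := q/‖Δ‖²` + `exemptNear_of_forceB_gt`] -/
theorem slab_or_exempt_of_ring {M : ℕ} {z : Fin M → E3} {c : Fin M} (hz : Function.Injective z) {U : E3 →L[ℝ] E3} {ξ₀ ξ : E3}
    (hU : ‖U - 1‖ ≤ 1 / 4) (hξ₀ : ‖ξ₀‖ ≤ 1 / 4) (hξ : ‖ξ‖ ≤ 1 / 4)
    (hrange : Set.range z = {x : E3 | dist x (z c) ≤ 133 / 10 ∧ ∃ a : Fin 3 → ℤ,
      x = z c + latPt U hexFrame a ∨ x = z c + latPt U hexFrame a + U (hcpShift + ξ)})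
    (B R : Finset (Fin 3 → ℤ)) (hB : B ⊆ Fintype.piFinset fun _ : Fin 3 => Finset.Icc (-11 : ℤ) 11)
    (hBin : ∀ bb ∈ B, ‖latPt U hexFrame bb + U (hcpShift + ξ)‖ ≤ 7)
    (hR : ∀ bb ∈ (Fintype.piFinset fun _ : Fin 3 => Finset.Icc (-11 : ℤ) 11) \ B, ‖latPt U hexFrame bb + U (hcpShift + ξ)‖ ≤ 7 →
      bb ∈ R ∧ 6 ≤ ‖latPt U hexFrame bb + U (hcpShift + ξ)‖)
    {q f₀ : ℝ}
    (hcurv : ∀ s ∈ Set.Ioo (0 : ℝ) 1, q ≤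
      ∑ bb ∈ B, segGd (fun x : ℝ => x⁻¹ ^ 7 - x⁻¹ ^ 13) (latPt U hexFrame bb + U (hcpShift + ξ₀)) (U (ξ - ξ₀)) s)
    (hf₀ : |∑ bb ∈ B, (‖latPt U hexFrame bb + U (hcpShift + ξ₀)‖⁻¹ ^ 8 - ‖latPt U hexFrame bb + U (hcpShift + ξ₀)‖⁻¹ ^ 14) *
        ⟪latPt U hexFrame bb + U (hcpShift + ξ₀), U (ξ - ξ₀)⟫| ≤ f₀ * ‖U (ξ - ξ₀)‖) :
    q ≤ ((6000 / 343 * (7 : ℝ)⁻¹ ^ 4 + 2880 / 49 * (7 : ℝ)⁻¹ ^ 5 + 10 / 7 * (7 : ℝ)⁻¹ ^ 6 + 2 * (7 : ℝ)⁻¹ ^ 7) + f₀ + R.card * (6 : ℝ)⁻¹ ^ 7) *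
        ‖U (ξ - ξ₀)‖ ∨ ExemptNear (9 / 5) ExRec z c := by
  classical
  set box := (Fintype.piFinset fun _ : Fin 3 => Finset.Icc (-11 : ℤ) 11) with hbox
  set S7 : ℝ := 6000 / 343 * (7 : ℝ)⁻¹ ^ 4 + 2880 / 49 * (7 : ℝ)⁻¹ ^ 5 + 10 / 7 * (7 : ℝ)⁻¹ ^ 6 + 2 * (7 : ℝ)⁻¹ ^ 7 with hS7
  set X : (Fin 3 → ℤ) → E3 := fun bb => latPt U hexFrame bb + U (hcpShift + ξ) with hX
  by_cases hΔ0 : U (ξ - ξ₀) = 0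
  · left
    have h := hcurv (1 / 2) ⟨by norm_num, by norm_num⟩
    rw [hΔ0] at h
    simp only [segGd_of_zero, Finset.sum_const_zero] at h
    rw [hΔ0, norm_zero, mul_zero]
    exact h
  rcases le_or_gt q ((S7 + f₀ + R.card * (6 : ℝ)⁻¹ ^ 7) * ‖U (ξ - ξ₀)‖) with hle | hlt
  · exact Or.inl hle
  right
  have hpos : 0 < ‖U (ξ - ξ₀)‖ := norm_pos_iff.2 hΔ0
  -- the ring lemma with `λ := q/‖Δ‖²`
  have hcurv' : ∀ s ∈ Set.Ioo (0 : ℝ) 1, q / ‖U (ξ - ξ₀)‖ ^ 2 * ‖U (ξ - ξ₀)‖ ^ 2 ≤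
      ∑ bb ∈ B, segGd (fun x : ℝ => x⁻¹ ^ 7 - x⁻¹ ^ 13) (latPt U hexFrame bb + U (hcpShift + ξ₀)) (U (ξ - ξ₀)) s := by
    intro s hs
    rw [div_mul_cancel₀ q (pow_ne_zero 2 hpos.ne')]
    exact hcurv s hs
  have hext := hcpForceLJ_exterior B hU hξ₀ hξ hcurv' hf₀
  have h1 : q / ‖U (ξ - ξ₀)‖ ^ 2 * ‖U (ξ - ξ₀)‖ = q / ‖U (ξ - ξ₀)‖ := by
    field_simp
  rw [h1] at hext
  -- the unit direction of the shuffle displacement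
  set e : E3 := ‖U (ξ - ξ₀)‖⁻¹ • U (ξ - ξ₀) with he
  have hne : ‖e‖ = 1 := by rw [he, norm_smul, norm_inv, norm_norm, inv_mul_cancel₀ hpos.ne']
  refine exemptNear_of_forceB_gt hz hU hξ hrange e hne.le ?_
  have hsplit := Finset.sum_sdiff hB (f := fun bb => if X bb ≠ 0 ∧ ‖X bb‖ ≤ 7 then (‖X bb‖⁻¹ ^ 8 - ‖X bb‖⁻¹ ^ 14) * ⟪X bb, e⟫ else 0)
  -- on `B` the indicator is on and `⟪X, e⟫ = ⟪X, Δ⟫/‖Δ‖`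
  have hBsum : ∑ bb ∈ B, (if X bb ≠ 0 ∧ ‖X bb‖ ≤ 7 then (‖X bb‖⁻¹ ^ 8 - ‖X bb‖⁻¹ ^ 14) * ⟪X bb, e⟫ else 0) =
      ‖U (ξ - ξ₀)‖⁻¹ * ∑ bb ∈ B, (‖X bb‖⁻¹ ^ 8 - ‖X bb‖⁻¹ ^ 14) * ⟪X bb, U (ξ - ξ₀)⟫ := by
    rw [Finset.mul_sum]
    refine Finset.sum_congr rfl fun bb hbb => ?_
    have hX0 : X bb ≠ 0 := norm_pos_iff.1 (lt_trans (by norm_num) (norm_shifted_gt hU hξ bb))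
    rw [if_pos ⟨hX0, hBin bb hbb⟩, he, real_inner_smul_right]
    ring
  have hrest := forceRest_ge box B R X hR hne.le
  -- the `B`-part exceeds `S₇♯ + |R|·6⁻⁷`
  have h2 : S7 + f₀ + R.card * (6 : ℝ)⁻¹ ^ 7 < q / ‖U (ξ - ξ₀)‖ := by
    rw [lt_div_iff₀ hpos]; exact hlt
  have h3 : (S7 + R.card * (6 : ℝ)⁻¹ ^ 7) * ‖U (ξ - ξ₀)‖ <
      ∑ bb ∈ B, (‖X bb‖⁻¹ ^ 8 - ‖X bb‖⁻¹ ^ 14) * ⟪X bb, U (ξ - ξ₀)⟫ := by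
    have : (S7 + R.card * (6 : ℝ)⁻¹ ^ 7) * ‖U (ξ - ξ₀)‖ < (q / ‖U (ξ - ξ₀)‖ - f₀) * ‖U (ξ - ξ₀)‖ :=
      mul_lt_mul_of_pos_right (by linarith) hpos
    exact lt_of_lt_of_le this hext
  have hBgt : S7 + R.card * (6 : ℝ)⁻¹ ^ 7 < ‖U (ξ - ξ₀)‖⁻¹ * ∑ bb ∈ B, (‖X bb‖⁻¹ ^ 8 - ‖X bb‖⁻¹ ^ 14) * ⟪X bb, U (ξ - ξ₀)⟫ := by
    rw [inv_mul_eq_div, lt_div_iff₀ hpos]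
    exact h3
  show S7 < ∑ bb ∈ box, (if X bb ≠ 0 ∧ ‖X bb‖ ≤ 7 then (‖X bb‖⁻¹ ^ 8 - ‖X bb‖⁻¹ ^ 14) * ⟪X bb, e⟫ else 0)
  rw [← hsplit, hBsum]
  linarith [hrest, hBgt]

end Summit.AtomisticToContinuum.Crystallization.Theorems.FrustratedLawDichotomyStrainedPatchHomExemptZeroStep

end
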